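import Literature.AlgebraicGeometry.HodgeTheory.FermatHodgeClassesLiftToCurveAndJacobianPowers
import Literature.AlgebraicGeometry.HodgeTheory.HodgeConjectureQbarVoisinProofs
import Literature.AlgebraicGeometry.HodgeTheory.HodgeRiemannPolarizability
import Literature.AlgebraicGeometry.Motives.AbelianVarietyProjectiveChart
import Literature.AlgebraicGeometry.HodgeTheory.GysinBaseChange
import Literature.AlgebraicGeometry.HodgeTheory.AlgebraicClassesExteriorProduct
import Literature.AlgebraicGeometry.HodgeTheory.TopDegreeClasses
import Literature.AlgebraicGeometry.HodgeTheory.ComplexGysin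
import Literature.AlgebraicGeometry.HodgeTheory.ComplexGysinHodgeType
import Literature.AlgebraicGeometry.HodgeTheory.CorrespondenceCupProductIdentities
import Literature.AlgebraicGeometry.HodgeTheory.HolomorphicBundleChernCharacterTopDegree
import Literature.AlgebraicTopology.SingularHomology.CompactGroupExteriorCohomology
import Literature.AlgebraicGeometry.HodgeTheory.AbelianVarietyPullbackAlgebraicClasses
import Literature.AlgebraicGeometry.Motives.JacobianDimensionBounds
import Literature.AlgebraicGeometry.HodgeTheory.PlaneCubicFirstBetti
import Literature.AlgebraicGeometry.HodgeTheory.FermatCubicSurfaceSevenLines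
import HarnessLib

/-!
# Hodge classes lift along pull-backs; the Abel–Jacobi lifting fact reduced to its inputs

Topic `Literature/AlgebraicGeometry/HodgeTheory`. Companion (theorems only, sorry-free) of
`FermatHodgeClassesLiftToCurveAndJacobianPowers.lean`, whose named fact
`CurvePowerHodgeClassesLiftToJacobianPowers` (Hodge classes on the powers `Cᴺ⁺¹` of a smooth
projective curve come, modulo algebraic classes, from Hodge classes on the powers `Jᴺ⁺¹` of its
Jacobian along `(αᴺ⁺¹)^*`, `α = f^P : C → J`) is ASSEMBLED from: Künneth and
`(f^P)^* : H¹(J) ≅ H¹(C)` (Lange 2023, §4.1.1 and proof of Lemma 4.4.1; Milne 1986, Thm. 2.5 — the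
tree's unproved named fact `Motives.isIso_bettiCohomology_map_abelJacobi`), which make
`(αᴺ⁺¹)^* : H*(Jᴺ⁺¹, ℚ) → H*(Cᴺ⁺¹, ℚ)` SURJECTIVE for `g ≥ 1`; the lifting of Hodge classes along a
surjective morphism from a polarised Hodge structure (C. Voisin, *Hodge and generalized Hodge
conjectures, coniveau and algebraic cycles*, J. Open Math. Probl. 1 (2025), Prop. 2.11 and
**Cor. 2.12**, p. 24, read: "Let `H, H′` be Hodge structures of weight `2k`, with `H′` polarized,
and let `φ : H′ → H` be a surjective morphism of Hodge structures. Then `φ : Hdg(H′) → Hdg(H)` is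
surjective. Indeed, this follows from the fact that, thanks to Proposition 2.11, `φ` has a left
inverse as morphism of Hodge structures."); and the contravariance of cycle classes (Fulton 1998,
Cor. 19.2).

This file proves, on the tree's real carriers (`complexBetti`, `IsRationalClass`,
`IsOfHodgeType`, `algebraicClasses`), the Hodge-theoretic step in the PULL-BACK form the fact
needs — the pull-back analogue of `Voisin2025_hodgeClass_lift_complexGysin` (file
`GysinHodgeClassLift`, Gysin form):

* `exists_isRationalClass_isOfHodgeType_map_eq_of_isPolarizable` — for a `ℂ`-morphism
  `g : Y ⟶ X` of smooth projective varieties, Hodge symmetric Hodge models `A` of `X` and `B` of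
  `Y`, and a polarisation of the weight-`2p` Hodge structure `A.hodgeStructure` on
  `H²ᵖ(X(ℂ); ℚ)` (`HodgeStructureOfHodgeModel`), **a RATIONAL class of type `(p, p)` on `Y` lying
  in the range of `g^* : H²ᵖ(X(ℂ); ℂ) → H²ᵖ(Y(ℂ); ℂ)` is `g^* b` for a RATIONAL class `b` of type
  `(p, p)` on `X`**. Proof as printed (Cor. 2.12 in the range form of Voisin 2007 / the tree's
  `Motives.HodgeStructure.Hom.exists_mem_hodgeClasses_eq_of_mem_range`): rational descent of the
  range (`exists_isRationalClass_complexBetti_map_eq`: `range (g^* ⊗ ℂ) ∩ H²ᵖ(Y; ℚ) = range g^*`),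
  `g^*` on `H²ᵖ(–(ℂ); ℚ)` is a morphism of the models' Hodge structures
  (`HodgeModel.hodgeStructureHom`), whose Hodge classes are exactly the rational classes of type
  `(p, p)` (`HodgeModel.mem_hodgeClasses_iff_isOfHodgeType_ringChange`, through the theorem
  `hodgePQ_independent_of_hodgeModel_holds`), and the polarisation argument.
* `exists_isRationalClass_isOfHodgeType_map_eq_of_mem_range`,
  `exists_isRationalClass_isOfHodgeType_map_eq_of_surjective` — the same with the models supplied
  by `exists_isReal_hodgeModel_holds` and the polarisation by the named fact
  `smoothProjective_hodgeStructure_isPolarizable` (`HodgeRiemannPolarizability`; Voisin I,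
  Thm. 6.32 and §7.1.2 — the one Hodge-theoretic input not yet proved on these carriers), in the
  range form and in the surjective form of Cor. 2.12.
* `curvePowerHodgeClassesLift_of_surjective` — **the body of
  `CurvePowerHodgeClassesLiftToJacobianPowers` at `(C, 𝒥, N, p)` from its remaining inputs**: a
  morphism `g : Cᴺ⁺¹ ⟶ Jᴺ⁺¹` (intended: `αᴺ⁺¹`) whose pull-back is surjective on `H²ᵖ(–(ℂ); ℂ)`
  (Künneth + the `H¹` isomorphism, case `g ≥ 1`) and maps algebraic classes to algebraic classes
  (Fulton Cor. 19.2 for `αᴺ⁺¹`; the tree has it for flat maps only,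
  `map_mem_algebraicClasses_of_flat`), plus `smoothProjective_hodgeStructure_isPolarizable`; then
  `G = g^*` and `a = G b` exactly.
* `algebraicClasses_pow_eq_top_of_subsingleton` — **if `H¹(C(ℂ); ℂ) = 0` (genus `0`), every
  class of every `H²ᵖ(Cᴹ(ℂ); ℂ)` is algebraic** (PROVED, no fact): by the Künneth spanning theorem
  (`kunnethSpan_complexBetti`) `H*(Cᴹ ⊗ C)` is spanned by the `fst^* b ∪ snd^* w`, where `w` lives
  in `H⁰(C)` (algebraic, `algebraicClasses_zero`), `H¹(C) = 0`, `H²(C)` (algebraic: top degree,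
  `mem_algebraicClasses_of_degree_top`) or `H^{≥3}(C) = 0`, and exterior products of algebraic
  classes are algebraic (`cupProduct_map_fst_map_snd_mem_algebraicClasses`) — Fulton Ex. 19.1.11
  ("every class of `H*((ℙ¹)ᴺ⁺¹, ℚ)` is a combination of cross products of point classes") without
  identifying `C ≅ ℙ¹`; whence `curvePowerHodgeClassesLift_of_subsingleton`, **the fact's body in
  genus `0`, unconditionally**, and `curvePowerHodgeClassesLift_of_lt` (degrees `p > N + 1`).
* `curvePowerHodgeClassesLift_of_algebraicClasses_eq_top`, `curvePowerHodgeClassesLift_zero` —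
  the body when every class of `H²ᵖ(Cᴺ⁺¹(ℂ); ℂ)` is algebraic (the case `g = 0`, where
  `H*((ℙ¹)ᴺ⁺¹)` is spanned by cross products of point classes, Fulton Ex. 19.1.11; and `p = 0`,
  `algebraicClasses_zero`): `G = 0`, `b = 0`, a Hodge model of `Jᴺ⁺¹` existing because abelian
  varieties are smooth projective (`Motives.AbelianVariety.isSmoothProjective_holds`,
  `nonempty_hodgeModel_holds`).

* `CurvePowerHodgeClassesLiftToJacobianPowers_of`,
  `CurvePowerHodgeClassesLiftToJacobianPowers_of_isIso_of_isPolarizable` — the assembly: the fact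
  from the `H¹` fact, the polarisability fact and the contravariance of algebraic classes along
  `αᴺ⁺¹` (the last PROVED in `AbelianVarietyPullbackAlgebraicClasses`, by moving supports with
  translations of `Jᴺ⁺¹` and the dimension of the general fibre).

Not here (what remains of `CurvePowerHodgeClassesLiftToJacobianPowers_holds`): the two named facts
`Motives.isIso_bettiCohomology_map_abelJacobi` (surjectivity of `(αᴺ⁺¹)^*`) and
`smoothProjective_hodgeStructure_isPolarizable`. No definition and no named fact is introduced
(D-0026).

## References

* [Voisin2025] C. Voisin, Hodge and generalized Hodge conjectures, coniveau and algebraic cycles,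
  J. Open Math. Probl. 1 (2025) 16–51, Prop. 2.11 and Cor. 2.12 (p. 23–24).
* [VoisinHodgeI2002] C. Voisin, Hodge Theory and Complex Algebraic Geometry I, CUP 2002, §7.1.1,
  §7.1.2, Lemma 7.26, §7.3.2.
* [Lange2023AbelianVarietiesC] H. Lange, Abelian Varieties over the Complex Numbers (2023),
  §4.1.1 and Lemma 4.4.1.
* [Fulton1998] W. Fulton, Intersection Theory, 2nd ed. (1998), §19.2 Cor. 19.2, Example 19.1.11.
* [HatcherAT2002] A. Hatcher, Algebraic Topology (2002), §3.1 (change of coefficients).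
-/

noncomputable section

open CategoryTheory AlgebraicGeometry
open Literature.AlgebraicTopology.SingularHomology
open Literature.AlgebraicGeometry.Motives

namespace Literature.AlgebraicGeometry.HodgeTheory

section HodgeLiftAlongPullback

variable {m n : ℕ} {X Y : Motives.SchemeOver ℂ}

/-- **Hodge classes lift along pull-backs (range form; Voisin 2025, Cor. 2.12 with Prop. 2.11).**
For a `ℂ`-morphism `g : Y ⟶ X` of smooth projective varieties, Hodge symmetric Hodge models `A` of
`X` and `B` of `Y`, and a polarisation of the weight-`2p` Hodge structure of `A` on `H²ᵖ(X(ℂ); ℚ)`,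
every RATIONAL class `a ∈ H²ᵖ(Y(ℂ); ℂ)` of Hodge type `(p, p)` lying in the range of
`g^* : H²ᵖ(X(ℂ); ℂ) → H²ᵖ(Y(ℂ); ℂ)` is `g^* b` for a RATIONAL class `b ∈ H²ᵖ(X(ℂ); ℂ)` of Hodge type
`(p, p)`: write `a = g^*(ι x₀)` with `x₀ ∈ H²ᵖ(X(ℂ); ℚ)` (rational descent of ranges); `g^*` on
`H²ᵖ(–(ℂ); ℚ)` is a morphism of Hodge structures `φ`, `φ x₀` is a Hodge class because `ι(φ x₀) = a`
is of type `(p, p)`, and "thanks to Proposition 2.11, `φ` has a left inverse as morphism of Hodge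
structures" on its range, giving a Hodge preimage `x₁`; `b = ι(x₁)`.
[cite: Voisin2025, Cor. 2.12 and Prop. 2.11] [cite: VoisinHodgeI2002, §7.1.1, Lemma 7.26 and §7.3.2] -/
theorem exists_isRationalClass_isOfHodgeType_map_eq_of_isPolarizable
    (hX : Motives.IsSmoothProjective n X) (hY : Motives.IsSmoothProjective m Y) (g : Y ⟶ X)
    (A : HodgeModel n X) (hA : A.IsHodgeSymmetric) (B : HodgeModel m Y) (hB : B.IsHodgeSymmetric)
    {p : ℕ} (hpol : (A.hodgeStructure hX hA (2 * p)).IsPolarizable)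
    {a : complexBetti Y (2 * p)} (ha : IsRationalClass a) (haH : IsOfHodgeType m Y (2 * p) p p a)
    (hrange : a ∈ LinearMap.range (complexBetti.map g (2 * p)).hom) :
    ∃ b : complexBetti X (2 * p), IsRationalClass b ∧ IsOfHodgeType n X (2 * p) p p b ∧
      complexBetti.map g (2 * p) b = a := by
  have hI : hodgePQ_independent_of_hodgeModel := hodgePQ_independent_of_hodgeModel_holds
  -- `a = g^* c`; rational descent of the range: `a = g^* (ι x₀)`, `x₀ ∈ H²ᵖ(X(ℂ); ℚ)`
  obtain ⟨c, hc⟩ := hrange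
  have hc' : complexBetti.map g (2 * p) c = a := hc
  obtain ⟨c₀, hc₀, hc₀eq⟩ :=
    exists_isRationalClass_complexBetti_map_eq hX g c (by rw [hc']; exact ha)
  obtain ⟨x₀, rfl⟩ := hc₀.exists_ringChange_eq
  set ιX := singularCohomology.ringChange (algebraMap ℚ ℂ) (Motives.ComplexPoints X) (2 * p)
    with hιX
  set ιY := singularCohomology.ringChange (algebraMap ℚ ℂ) (Motives.ComplexPoints Y) (2 * p)
    with hιY
  have hga : complexBetti.map g (2 * p) (ιX x₀) = a := hc₀eq.trans hc'
  -- `g^*` on rational cohomology is a morphism of the models' Hodge structures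
  set φ := A.hodgeStructureHom hX hI hA B hY hB g (2 * p) with hφ
  have hφx : ∀ x, ιY (φ.toLinearMap x) = complexBetti.map g (2 * p) (ιX x) := fun x ↦ by
    rw [hφ, HodgeModel.hodgeStructureHom_toLinearMap, hιY, hιX]
    exact ringChange_map (Motives.AlgPoints.mapContinuous (L := ℂ) g) x
  -- `φ x₀` is a Hodge class of `H_Y`: its image `a` in `H²ᵖ(Y(ℂ); ℂ)` is of type `(p, p)`
  have hx₀ : φ.toLinearMap x₀ ∈ (B.hodgeStructure hY hB (2 * p)).hodgeClasses p :=
    (B.mem_hodgeClasses_iff_isOfHodgeType_ringChange hY hI hB p _).2 (by rw [hφx, hga]; exact haH)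
  -- the polarisation argument (Prop. 2.11 ⇒ Cor. 2.12 in range form): a Hodge preimage `x₁`
  haveI : Module.Finite ℚ (singularCohomology ℚ ℚ (Motives.ComplexPoints X) (2 * p)) :=
    finite_singularCohomology_rat_complexPoints hX _
  obtain ⟨x₁, hx₁, hx₁eq⟩ := φ.exists_mem_hodgeClasses_eq_of_mem_range hpol (p := (p : ℤ))
    (by push_cast; ring) hx₀ (LinearMap.mem_range_self _ x₀)
  refine ⟨ιX x₁, isRationalClass_ringChange x₁,
    (A.mem_hodgeClasses_iff_isOfHodgeType_ringChange hX hI hA p x₁).1 hx₁, ?_⟩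
  rw [← hφx, hx₁eq, hφx, hga]

/-- **Hodge classes lift along pull-backs (range form), from the named fact
`smoothProjective_hodgeStructure_isPolarizable`.** For `g : Y ⟶ X` a `ℂ`-morphism of smooth
projective varieties, a rational class of type `(p, p)` on `Y` in the range of
`g^* : H²ᵖ(X(ℂ); ℂ) → H²ᵖ(Y(ℂ); ℂ)` is `g^* b` for a rational class `b` of type `(p, p)` on `X`
(Voisin 2025, Cor. 2.12; real — hence Hodge symmetric — models by `exists_isReal_hodgeModel_holds`).
[cite: Voisin2025, Cor. 2.12 and Prop. 2.11] [cite: VoisinHodgeI2002, Thm. 6.32, §7.1.2 and §7.3.2] -/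
theorem exists_isRationalClass_isOfHodgeType_map_eq_of_mem_range
    (hpol : smoothProjective_hodgeStructure_isPolarizable)
    (hX : Motives.IsSmoothProjective n X) (hY : Motives.IsSmoothProjective m Y) (g : Y ⟶ X)
    (p : ℕ) {a : complexBetti Y (2 * p)} (ha : IsRationalClass a)
    (haH : IsOfHodgeType m Y (2 * p) p p a)
    (hrange : a ∈ LinearMap.range (complexBetti.map g (2 * p)).hom) :
    ∃ b : complexBetti X (2 * p), IsRationalClass b ∧ IsOfHodgeType n X (2 * p) p p b ∧
      complexBetti.map g (2 * p) b = a := by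
  obtain ⟨A, hA⟩ := exists_isReal_hodgeModel_holds n X hX
  obtain ⟨B, hB⟩ := exists_isReal_hodgeModel_holds m Y hY
  exact exists_isRationalClass_isOfHodgeType_map_eq_of_isPolarizable hX hY g A hA.isHodgeSymmetric
    B hB.isHodgeSymmetric (hpol hX A hA.isHodgeSymmetric (2 * p)) ha haH hrange

/-- **Hodge classes lift along surjective pull-backs** (Voisin 2025, Cor. 2.12 verbatim for
`φ = g^*`: "let `φ : H′ → H` be a surjective morphism of Hodge structures. Then
`φ : Hdg(H′) → Hdg(H)` is surjective"), from `smoothProjective_hodgeStructure_isPolarizable`: if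
`g^* : H²ᵖ(X(ℂ); ℂ) → H²ᵖ(Y(ℂ); ℂ)` is surjective, every rational class of type `(p, p)` on `Y` is
`g^* b` for a rational class `b` of type `(p, p)` on `X`.
[cite: Voisin2025, Cor. 2.12] [cite: VoisinHodgeI2002, Thm. 6.32 and §7.3.2] -/
theorem exists_isRationalClass_isOfHodgeType_map_eq_of_surjective
    (hpol : smoothProjective_hodgeStructure_isPolarizable)
    (hX : Motives.IsSmoothProjective n X) (hY : Motives.IsSmoothProjective m Y) (g : Y ⟶ X)
    (p : ℕ) (hsurj : Function.Surjective (complexBetti.map g (2 * p)).hom)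
    {a : complexBetti Y (2 * p)} (ha : IsRationalClass a) (haH : IsOfHodgeType m Y (2 * p) p p a) :
    ∃ b : complexBetti X (2 * p), IsRationalClass b ∧ IsOfHodgeType n X (2 * p) p p b ∧
      complexBetti.map g (2 * p) b = a :=
  exists_isRationalClass_isOfHodgeType_map_eq_of_mem_range hpol hX hY g p ha haH
    (by rw [LinearMap.range_eq_top.2 hsurj]; exact Submodule.mem_top)

end HodgeLiftAlongPullback

/-! ### The body of `CurvePowerHodgeClassesLiftToJacobianPowers` from its remaining inputs -/

section CurvePowers

/-- Powers `Cᴺ⁺¹` (`Motives.SchemeOver.pow`) of a smooth projective curve are smooth projective of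
dimension `N + 1`. [folklore] -/
theorem isSmoothProjective_pow_succ_of_curve {C : SchemeOver ℂ} (hC : IsSmoothProjective 1 C)
    (N : ℕ) : IsSmoothProjective (N + 1) (C.pow (N + 1)) := by
  simpa using hC.pow (N + 1)

/-- Powers `Jᴺ⁺¹ = (𝒥.J.powSucc N).X` of a Jacobian are smooth projective of dimension
`(𝒥.J.powSucc N).dim` (abelian varieties are smooth projective, Mumford §4 (ii) and §6 App. 1:
`Motives.AbelianVariety.isSmoothProjective_holds`). [cite: MumfordAV1970, §4 (ii) and §6 Application 1 (p. 62)] -/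
theorem isSmoothProjective_powSucc_jacobian {C : SchemeOver ℂ} (𝒥 : Jacobian C) (N : ℕ) :
    IsSmoothProjective (𝒥.J.powSucc N).dim (𝒥.J.powSucc N).X :=
  AbelianVariety.isSmoothProjective_holds

/-- **The body of `CurvePowerHodgeClassesLiftToJacobianPowers` at `(C, 𝒥, N, p)` from its
remaining inputs** (the case `g ≥ 1` of the assembled argument): given a `ℂ`-morphism
`g : Cᴺ⁺¹ ⟶ Jᴺ⁺¹` (intended: `αᴺ⁺¹`, `α = f^P`) whose pull-back on `H²ᵖ(–(ℂ); ℂ)` is SURJECTIVE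
(Künneth and `(f^P)^* : H¹(J) ≅ H¹(C)`, Lange §4.1.1 / Lemma 4.4.1 — the named fact
`Motives.isIso_bettiCohomology_map_abelJacobi`) and maps algebraic classes to algebraic classes
(Fulton Cor. 19.2: `cl` is contravariant for morphisms of non-singular varieties), and granted the
polarisability `smoothProjective_hodgeStructure_isPolarizable`, the conclusion of the fact holds
with `G = g^*` and `a = G b` exactly (Voisin 2025, Cor. 2.12:
`exists_isRationalClass_isOfHodgeType_map_eq_of_surjective`).
[cite: Voisin2025, Cor. 2.12] [cite: Lange2023AbelianVarietiesC, §4.1.1 and Lemma 4.4.1 (proof)]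
[cite: Fulton1998, §19.2 Cor. 19.2] -/
theorem curvePowerHodgeClassesLift_of_surjective
    (hpol : smoothProjective_hodgeStructure_isPolarizable)
    {C : SchemeOver ℂ} (hC : IsSmoothProjective 1 C) (𝒥 : Jacobian C) (N p : ℕ)
    (g : C.pow (N + 1) ⟶ (𝒥.J.powSucc N).X)
    (hsurj : Function.Surjective (complexBetti.map g (2 * p)).hom)
    (halg : ∀ b ∈ algebraicClasses (𝒥.J.powSucc N).X p,
      complexBetti.map g (2 * p) b ∈ algebraicClasses (C.pow (N + 1)) p) :
    ∃ G : complexBetti (𝒥.J.powSucc N).X (2 * p) →ₗ[ℂ] complexBetti (C.pow (N + 1)) (2 * p),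
      (∀ b ∈ algebraicClasses (𝒥.J.powSucc N).X p, G b ∈ algebraicClasses (C.pow (N + 1)) p) ∧
      ∀ a : complexBetti (C.pow (N + 1)) (2 * p), IsRationalClass a →
        IsOfHodgeType (N + 1) (C.pow (N + 1)) (2 * p) p p a →
          ∃ b : complexBetti (𝒥.J.powSucc N).X (2 * p), IsRationalClass b ∧
            IsOfHodgeType (𝒥.J.powSucc N).dim (𝒥.J.powSucc N).X (2 * p) p p b ∧
            a - G b ∈ algebraicClasses (C.pow (N + 1)) p := by
  refine ⟨(complexBetti.map g (2 * p)).hom, halg, fun a ha haH ↦ ?_⟩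
  obtain ⟨b, hb, hbH, hgb⟩ := exists_isRationalClass_isOfHodgeType_map_eq_of_surjective hpol
    (isSmoothProjective_powSucc_jacobian 𝒥 N) (isSmoothProjective_pow_succ_of_curve hC N) g p
    hsurj ha haH
  refine ⟨b, hb, hbH, ?_⟩
  have hgb' : (complexBetti.map g (2 * p)).hom b = a := hgb
  rw [hgb', sub_self]
  exact Submodule.zero_mem _

/-- **The body of `CurvePowerHodgeClassesLiftToJacobianPowers` when every class of
`H²ᵖ(Cᴺ⁺¹(ℂ); ℂ)` is algebraic** — the case `g = 0` (`C ≅ ℙ¹`, `J = 0`: every class of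
`H*((ℙ¹)ᴺ⁺¹, ℚ)` is a combination of cross products of point classes, Fulton Ex. 19.1.11) and the
degree `p = 0`: `G = 0` and `b = 0`, the latter being of type `(p, p)` through a Hodge model of the
smooth projective `Jᴺ⁺¹` (`nonempty_hodgeModel_holds`). [cite: Fulton1998, Example 19.1.11] -/
theorem curvePowerHodgeClassesLift_of_algebraicClasses_eq_top {C : SchemeOver ℂ} (𝒥 : Jacobian C)
    (N p : ℕ) (htop : algebraicClasses (C.pow (N + 1)) p = ⊤) :
    ∃ G : complexBetti (𝒥.J.powSucc N).X (2 * p) →ₗ[ℂ] complexBetti (C.pow (N + 1)) (2 * p),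
      (∀ b ∈ algebraicClasses (𝒥.J.powSucc N).X p, G b ∈ algebraicClasses (C.pow (N + 1)) p) ∧
      ∀ a : complexBetti (C.pow (N + 1)) (2 * p), IsRationalClass a →
        IsOfHodgeType (N + 1) (C.pow (N + 1)) (2 * p) p p a →
          ∃ b : complexBetti (𝒥.J.powSucc N).X (2 * p), IsRationalClass b ∧
            IsOfHodgeType (𝒥.J.powSucc N).dim (𝒥.J.powSucc N).X (2 * p) p p b ∧
            a - G b ∈ algebraicClasses (C.pow (N + 1)) p := by
  obtain ⟨M⟩ := (nonempty_hodgeModel_holds (n := (𝒥.J.powSucc N).dim)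
    (X := (𝒥.J.powSucc N).X)).nonempty (isSmoothProjective_powSucc_jacobian 𝒥 N)
  refine ⟨0, fun b _ ↦ by rw [LinearMap.zero_apply]; exact Submodule.zero_mem _, fun a _ _ ↦ ?_⟩
  refine ⟨0, IsRationalClass.zero, IsOfHodgeType.zero M (2 * p) p p, ?_⟩
  rw [map_zero, sub_zero, htop]
  exact Submodule.mem_top

/-- **The fact in degree `0`**: `algebraicClasses _ 0 = H⁰` (`algebraicClasses_zero`, the Hodge
conjecture in codimension `0`), so the body of `CurvePowerHodgeClassesLiftToJacobianPowers` holds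
at `p = 0` for every curve and every `N`. [cite: VoisinHodgeI2002, §11.3] -/
theorem curvePowerHodgeClassesLift_zero {C : SchemeOver ℂ} (𝒥 : Jacobian C) (N : ℕ) :
    ∃ G : complexBetti (𝒥.J.powSucc N).X (2 * 0) →ₗ[ℂ] complexBetti (C.pow (N + 1)) (2 * 0),
      (∀ b ∈ algebraicClasses (𝒥.J.powSucc N).X 0, G b ∈ algebraicClasses (C.pow (N + 1)) 0) ∧
      ∀ a : complexBetti (C.pow (N + 1)) (2 * 0), IsRationalClass a →
        IsOfHodgeType (N + 1) (C.pow (N + 1)) (2 * 0) 0 0 a →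
          ∃ b : complexBetti (𝒥.J.powSucc N).X (2 * 0), IsRationalClass b ∧
            IsOfHodgeType (𝒥.J.powSucc N).dim (𝒥.J.powSucc N).X (2 * 0) 0 0 b ∧
            a - G b ∈ algebraicClasses (C.pow (N + 1)) 0 :=
  curvePowerHodgeClassesLift_of_algebraicClasses_eq_top 𝒥 N 0 algebraicClasses_zero

end CurvePowers

/-! ### Genus `0`: every class on `Cᴹ` is algebraic when `H¹(C(ℂ); ℂ) = 0` -/

section GenusZero

open MonoidalCategory CartesianMonoidalCategory

variable {C : SchemeOver ℂ}

/-- The Künneth generators `fst^* b ∪ snd^* w` of `H²ᵖ((Cᴹ ⊗ C)(ℂ); ℂ)` are algebraic when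
`H¹(C(ℂ); ℂ) = 0` and all even-degree classes on `Cᴹ` are algebraic: `w ∈ H⁰(C)` or `H²(C)` is
algebraic (`algebraicClasses_zero`, `mem_algebraicClasses_of_degree_top`), `H¹(C) = 0 = H^{≥3}(C)`,
and exterior products of algebraic classes are algebraic. [cite: Fulton1998, Example 19.1.11] -/
theorem kunnethGenerator_mem_algebraicClasses_of_subsingleton (hC : IsSmoothProjective 1 C)
    [Subsingleton (complexBetti C 1)] {M : ℕ} (hM : IsSmoothProjective M (C.pow M))
    (IH : ∀ p, algebraicClasses (C.pow M) p = ⊤) {p i j : ℕ} (h : i + j = 2 * p)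
    (b : complexBetti (C.pow M) i) (w : complexBetti C j) :
    cupProduct h (complexBetti.map (fst (C.pow M) C) i b) (complexBetti.map (snd (C.pow M) C) j w)
      ∈ algebraicClasses (C.pow M ⊗ C) p := by
  by_cases hj : j = 0 ∨ j = 2
  · -- `w ∈ H⁰(C)` or `w ∈ H²(C)`: both algebraic; write `j = 2k`, `i = 2l`, `p = l + k`
    obtain ⟨k, rfl⟩ : ∃ k, j = 2 * k := ⟨j / 2, by omega⟩
    obtain ⟨l, rfl⟩ : ∃ l, i = 2 * l := ⟨p - k, by omega⟩
    obtain rfl : p = l + k := by omega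
    have hb : b ∈ algebraicClasses (C.pow M) l := by rw [IH]; exact Submodule.mem_top
    have hw : w ∈ algebraicClasses C k := by
      rcases hj with h0 | h2
      · obtain rfl : k = 0 := by omega
        rw [algebraicClasses_zero]; exact Submodule.mem_top
      · obtain rfl : k = 1 := by omega
        exact mem_algebraicClasses_of_degree_top hC le_rfl w
    exact cupProduct_map_fst_map_snd_mem_algebraicClasses hM hC hb hw
  · -- `w ∈ Hʲ(C) = 0` for `j = 1` (genus `0`) and `j ≥ 3`
    have hsub : Subsingleton (complexBetti C j) := by
      by_cases hj1 : j = 1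
      · subst hj1; infer_instance
      · exact subsingleton_complexBetti hC (by omega)
    rw [Subsingleton.elim w 0]
    simp only [map_zero]
    exact Submodule.zero_mem _

/-- **Genus `0`: every class of `H²ᵖ(Cᴹ(ℂ); ℂ)` is algebraic when `H¹(C(ℂ); ℂ) = 0`** (Fulton,
Ex. 19.1.11: on `(ℙ¹)ᴹ` every class is a combination of cross products of point classes), proved on
the tree's carriers by induction on `M` through the Künneth spanning theorem for `Cᴹ⁺¹ = Cᴹ ⊗ C`
(`kunnethSpan_complexBetti`) and `kunnethGenerator_mem_algebraicClasses_of_subsingleton`; `C⁰ = Spec ℂ`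
has `H⁰` algebraic and `H^{>0} = 0`. [cite: Fulton1998, Example 19.1.11] [cite: HatcherAT2002, §3.2 Thm. 3.15] -/
theorem algebraicClasses_pow_eq_top_of_subsingleton (hC : IsSmoothProjective 1 C)
    [Subsingleton (complexBetti C 1)] : ∀ (M p : ℕ), algebraicClasses (C.pow M) p = ⊤
  | 0, 0 => algebraicClasses_zero
  | 0, p + 1 =>
    algebraicClasses_eq_top_of_lt (isSmoothProjective_unit_holds ℂ : IsSmoothProjective 0 (C.pow 0))
      (by omega)
  | M + 1, p => by
    have hM : IsSmoothProjective M (C.pow M) := by simpa using hC.pow M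
    refine eq_top_iff.2 fun z _ ↦ ?_
    have hz := kunnethSpan_complexBetti hM hC (2 * p) z
    refine (Submodule.span_le.2 ?_) hz
    rintro _ ⟨i, j, h, b, w, rfl⟩
    exact kunnethGenerator_mem_algebraicClasses_of_subsingleton hC hM
      (algebraicClasses_pow_eq_top_of_subsingleton hC M) h b w

/-- **The body of `CurvePowerHodgeClassesLiftToJacobianPowers` in genus `0`, unconditionally**:
if `H¹(C(ℂ); ℂ) = 0` then every class on `Cᴺ⁺¹` is algebraic
(`algebraicClasses_pow_eq_top_of_subsingleton`), so `G = 0`, `b = 0` do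
(`curvePowerHodgeClassesLift_of_algebraicClasses_eq_top`). [cite: Fulton1998, Example 19.1.11] -/
theorem curvePowerHodgeClassesLift_of_subsingleton (hC : IsSmoothProjective 1 C)
    [Subsingleton (complexBetti C 1)] (𝒥 : Jacobian C) (N p : ℕ) :
    ∃ G : complexBetti (𝒥.J.powSucc N).X (2 * p) →ₗ[ℂ] complexBetti (C.pow (N + 1)) (2 * p),
      (∀ b ∈ algebraicClasses (𝒥.J.powSucc N).X p, G b ∈ algebraicClasses (C.pow (N + 1)) p) ∧
      ∀ a : complexBetti (C.pow (N + 1)) (2 * p), IsRationalClass a →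
        IsOfHodgeType (N + 1) (C.pow (N + 1)) (2 * p) p p a →
          ∃ b : complexBetti (𝒥.J.powSucc N).X (2 * p), IsRationalClass b ∧
            IsOfHodgeType (𝒥.J.powSucc N).dim (𝒥.J.powSucc N).X (2 * p) p p b ∧
            a - G b ∈ algebraicClasses (C.pow (N + 1)) p :=
  curvePowerHodgeClassesLift_of_algebraicClasses_eq_top 𝒥 N p
    (algebraicClasses_pow_eq_top_of_subsingleton hC (N + 1) p)

/-- **The body of `CurvePowerHodgeClassesLiftToJacobianPowers` in degrees `p > N + 1`**, where
`H²ᵖ(Cᴺ⁺¹(ℂ); ℂ) = 0`. [cite: HatcherAT2002, §3.3 Prop. 3.29] -/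
theorem curvePowerHodgeClassesLift_of_lt (hC : IsSmoothProjective 1 C) (𝒥 : Jacobian C) {N p : ℕ}
    (hp : N + 1 < p) :
    ∃ G : complexBetti (𝒥.J.powSucc N).X (2 * p) →ₗ[ℂ] complexBetti (C.pow (N + 1)) (2 * p),
      (∀ b ∈ algebraicClasses (𝒥.J.powSucc N).X p, G b ∈ algebraicClasses (C.pow (N + 1)) p) ∧
      ∀ a : complexBetti (C.pow (N + 1)) (2 * p), IsRationalClass a →
        IsOfHodgeType (N + 1) (C.pow (N + 1)) (2 * p) p p a →
          ∃ b : complexBetti (𝒥.J.powSucc N).X (2 * p), IsRationalClass b ∧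
            IsOfHodgeType (𝒥.J.powSucc N).dim (𝒥.J.powSucc N).X (2 * p) p p b ∧
            a - G b ∈ algebraicClasses (C.pow (N + 1)) p :=
  curvePowerHodgeClassesLift_of_algebraicClasses_eq_top 𝒥 N p
    (algebraicClasses_eq_top_of_lt (isSmoothProjective_pow_succ_of_curve hC N) hp)

end GenusZero

/-! ### Genus `≥ 1`: `(αᴺ⁺¹)^*` is onto, from the `H¹` fact; the assembly -/

section Surjectivity

open MonoidalCategory CartesianMonoidalCategory

variable {m m' : ℕ} {X X' Y Y' : SchemeOver ℂ}

/-- **Pull-back along a product of maps is onto when the factors are** (Künneth): for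
`f : Y ⟶ X`, `g : Y' ⟶ X'` with `Y`, `Y'` smooth projective and `f^*`, `g^*` onto in every degree,
`(f × g)^* : Hᵏ((X ⊗ X')(ℂ); ℂ) → Hᵏ((Y ⊗ Y')(ℂ); ℂ)` is onto: `Hᵏ((Y ⊗ Y')(ℂ))` is spanned by the
`fst^* b ∪ snd^* w` (`kunnethSpan_complexBetti`), and
`fst^* f^* b' ∪ snd^* g^* w' = (f × g)^* (fst^* b' ∪ snd^* w')`.
[cite: HatcherAT2002, §3.2 Thm. 3.15 and Prop. 3.10] -/
theorem surjective_complexBetti_map_tensorHom (hY : IsSmoothProjective m Y)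
    (hY' : IsSmoothProjective m' Y') (f : Y ⟶ X) (g : Y' ⟶ X')
    (hf : ∀ k, Function.Surjective (complexBetti.map f k).hom)
    (hg : ∀ k, Function.Surjective (complexBetti.map g k).hom) (k : ℕ) :
    Function.Surjective (complexBetti.map (f ⊗ₘ g) k).hom := by
  rw [← LinearMap.range_eq_top, eq_top_iff]
  intro z _
  refine (Submodule.span_le.2 ?_) (kunnethSpan_complexBetti hY hY' k z)
  rintro _ ⟨i, j, h, b, w, rfl⟩
  obtain ⟨b', rfl⟩ := hf i b
  obtain ⟨w', rfl⟩ := hg j w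
  refine ⟨cupProduct h (complexBetti.map (fst X X') i b') (complexBetti.map (snd X X') j w'), ?_⟩
  have e1 : complexBetti.map (f ⊗ₘ g) i (complexBetti.map (fst X X') i b') =
      complexBetti.map (fst Y Y') i (complexBetti.map f i b') := by
    rw [← complexBetti.map_comp_apply', ← complexBetti.map_comp_apply', tensorHom_fst]
  have e2 : complexBetti.map (f ⊗ₘ g) j (complexBetti.map (snd X X') j w') =
      complexBetti.map (snd Y Y') j (complexBetti.map g j w') := by
    rw [← complexBetti.map_comp_apply', ← complexBetti.map_comp_apply', tensorHom_snd]
  change complexBetti.map (f ⊗ₘ g) k _ = _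
  rw [complexBetti.map_cupProduct, e1, e2]

/-- Pull-back along an isomorphism is onto (`e^* (e⁻¹)^* = 𝟙`). [folklore] -/
theorem surjective_complexBetti_map_of_iso (e : Y ≅ X) (k : ℕ) :
    Function.Surjective (complexBetti.map e.hom k).hom := fun c ↦
  ⟨complexBetti.map e.inv k c, by
    change complexBetti.map e.hom k (complexBetti.map e.inv k c) = c
    rw [← complexBetti.map_comp_apply', Iso.hom_inv_id, complexBetti.map_id]
    rfl⟩

/-- **`f^*` is onto `H⁰`** for `f : Y ⟶ X` with `Y` smooth projective (`Y(ℂ)` is path connected,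
so `H⁰(Y(ℂ); ℂ) = ℂ · 1` and `f^* 1 = 1`). [cite: HatcherAT2002, §3.1 p. 199 and Prop. 3.10] -/
theorem surjective_complexBetti_map_zero (hY : IsSmoothProjective m Y) (f : Y ⟶ X) :
    Function.Surjective (complexBetti.map f 0).hom := fun a ↦ by
  haveI := pathConnectedSpace_complexPoints_of_isSmoothProjective hY
  refine ⟨(singularCohomologyZeroEquiv ℂ ℂ (Motives.ComplexPoints Y) a) •
    singularCohomology.one ℂ (Motives.ComplexPoints X), ?_⟩
  rw [map_smul]
  change _ • singularCohomology.map ℂ ℂ (Motives.AlgPoints.mapContinuous (L := ℂ) f) 0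
    (singularCohomology.one ℂ (Motives.ComplexPoints X)) = a
  rw [singularCohomology.map_one]
  exact (singularCohomology.eq_smul_one ℂ a).symm

variable {C : SchemeOver ℂ}

/-- **`(f^P)^*` is onto `H¹(C(ℂ); ℂ)`**, from the named fact
`Motives.isIso_bettiCohomology_map_abelJacobi` (`(f^P)^* : H¹(J(ℂ); ℚ) ≅ H¹(C(ℂ); ℚ)`, Lange
§4.1.1 and proof of Lemma 4.4.1): rational classes span `H¹(C(ℂ); ℂ)`
(`span_isRationalClass_eq_top_of_isSmoothProjective_holds`) and `ι ∘ (f^P)^*_ℚ = (f^P)^*_ℂ ∘ ι`.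
[cite: Lange2023AbelianVarietiesC, §4.1.1 and Lemma 4.4.1 (proof)] [cite: VoisinHodgeI2002, §7.1.1] -/
theorem surjective_complexBetti_map_abelJacobi_one (h1 : isIso_bettiCohomology_map_abelJacobi)
    (hC : IsSmoothProjective 1 C) (𝒥 : Jacobian C) (P : AlgPoints C ℂ) :
    Function.Surjective (complexBetti.map (𝒥.abelJacobi P) 1).hom := by
  haveI := h1 C hC 𝒥 P
  have hQ : Function.Surjective (bettiCohomology.map (𝒥.abelJacobi P) 1).hom :=
    (asIso (bettiCohomology.map (𝒥.abelJacobi P) 1)).toLinearEquiv.surjective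
  rw [← LinearMap.range_eq_top, eq_top_iff,
    ← span_isRationalClass_eq_top_of_isSmoothProjective_holds 1 C hC 1, Submodule.span_le]
  rintro c hc
  obtain ⟨x, rfl⟩ := IsRationalClass.exists_ringChange_eq hc
  obtain ⟨y, rfl⟩ := hQ x
  exact ⟨singularCohomology.ringChange (algebraMap ℚ ℂ) _ 1 y,
    (ringChange_map (Motives.AlgPoints.mapContinuous (L := ℂ) (𝒥.abelJacobi P)) y).symm⟩

/-- **Poincaré duality on the curve**: if `H¹(C(ℂ); ℂ) ≠ 0` there are degree-one classes with
non-zero cup product (the cup pairing of the closed oriented surface `C(ℂ)` is perfect, Hatcher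
Prop. 3.38 — the tree's `eq_zero_of_forall_cupPairing_eq_zero`). [cite: HatcherAT2002, §3.3 Prop. 3.38] -/
theorem exists_cupProduct_ne_zero_of_nontrivial (hC : IsSmoothProjective 1 C)
    [Nontrivial (complexBetti C 1)] :
    ∃ x y : complexBetti C 1, cupProduct (show 1 + 1 = 2 * 1 from rfl) x y ≠ 0 := by
  let μ : OrientationFamily := fun _ _ h ↦
    Classical.choice (Motives.ComplexPoints.isOrientableOver ℂ h)
  obtain ⟨x, hx⟩ := exists_ne (0 : complexBetti C 1)
  have hx' : ¬ ∀ y : complexBetti C 1, cupProduct (show 1 + 1 = 2 * 1 from rfl) x y = 0 :=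
    fun hall ↦ hx (eq_zero_of_forall_cupPairing_eq_zero μ hC (show 1 + 1 = 2 * 1 from rfl)
      fun b ↦ by rw [cupPairing_apply, hall b, map_zero, LinearMap.zero_apply])
  obtain ⟨y, hy⟩ := not_forall.1 hx'
  exact ⟨x, y, hy⟩

/-- **`(f^P)^*` is onto `H²(C(ℂ); ℂ)` when `b₁(C) ≠ 0`**, granted the `H¹` fact: a non-zero cup
product `x ∪ y` of degree-one classes (`exists_cupProduct_ne_zero_of_nontrivial`) is
`(f^P)^*(x' ∪ y')` for `x = (f^P)^* x'`, `y = (f^P)^* y'`, a non-zero element of the range inside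
the line `H²(C(ℂ); ℂ)` (`finrank_complexBetti_two_mul_eq_one`), which is therefore everything
(Lange, proof of Lemma 4.4.1: `H*(C)` is generated by `H¹`). [cite: Lange2023AbelianVarietiesC, Lemma 4.4.1 (proof)]
[cite: HatcherAT2002, §3.3 Prop. 3.38] -/
theorem surjective_complexBetti_map_abelJacobi_two (h1 : isIso_bettiCohomology_map_abelJacobi)
    (hC : IsSmoothProjective 1 C) (𝒥 : Jacobian C) (P : AlgPoints C ℂ)
    [Nontrivial (complexBetti C 1)] :
    Function.Surjective (complexBetti.map (𝒥.abelJacobi P) (2 * 1)).hom := by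
  obtain ⟨x, y, hxy⟩ := exists_cupProduct_ne_zero_of_nontrivial hC
  have hs1 := surjective_complexBetti_map_abelJacobi_one h1 hC 𝒥 P
  obtain ⟨x', rfl⟩ := hs1 x
  obtain ⟨y', rfl⟩ := hs1 y
  set f := (complexBetti.map (𝒥.abelJacobi P) (2 * 1)).hom with hf
  have hmem : cupProduct (show 1 + 1 = 2 * 1 from rfl)
      ((complexBetti.map (𝒥.abelJacobi P) 1).hom x')
      ((complexBetti.map (𝒥.abelJacobi P) 1).hom y') ∈ LinearMap.range f := by
    refine LinearMap.mem_range.2 ⟨cupProduct (show 1 + 1 = 2 * 1 from rfl) x' y', ?_⟩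
    rw [hf]
    exact complexBetti.map_cupProduct (𝒥.abelJacobi P) _ x' y'
  -- `H²(C(ℂ); ℂ)` is a line, so the range is everything
  have hfr : Module.finrank ℂ (complexBetti C (2 * 1)) = 1 := finrank_complexBetti_two_mul_eq_one hC
  haveI : FiniteDimensional ℂ (complexBetti C (2 * 1)) := Module.finite_of_finrank_eq_succ hfr
  rw [← LinearMap.range_eq_top]
  apply Submodule.eq_top_of_finrank_eq
  rw [hfr]
  refine le_antisymm ((Submodule.finrank_le _).trans hfr.le) ?_
  rw [Nat.one_le_iff_ne_zero, Ne, Submodule.finrank_eq_zero]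
  intro hbot
  rw [hbot, Submodule.mem_bot] at hmem
  exact hxy hmem

/-- **`(f^P)^* : Hᵏ(J(ℂ); ℂ) → Hᵏ(C(ℂ); ℂ)` is onto in every degree when `b₁(C) ≠ 0`** (genus
`≥ 1`), granted the `H¹` fact: degrees `0` (units), `1` (the fact), `2` (Poincaré duality), and
`Hᵏ(C(ℂ)) = 0` for `k ≥ 3`. [cite: Lange2023AbelianVarietiesC, §4.1.1 and Lemma 4.4.1 (proof)] -/
theorem surjective_complexBetti_map_abelJacobi (h1 : isIso_bettiCohomology_map_abelJacobi)
    (hC : IsSmoothProjective 1 C) (𝒥 : Jacobian C) (P : AlgPoints C ℂ)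
    [Nontrivial (complexBetti C 1)] (k : ℕ) :
    Function.Surjective (complexBetti.map (𝒥.abelJacobi P) k).hom := by
  match k with
  | 0 => exact surjective_complexBetti_map_zero hC _
  | 1 => exact surjective_complexBetti_map_abelJacobi_one h1 hC 𝒥 P
  | 2 =>
    have h := surjective_complexBetti_map_abelJacobi_two h1 hC 𝒥 P
    rwa [show 2 * 1 = 2 from rfl] at h
  | k + 3 =>
    haveI := subsingleton_complexBetti hC (k := k + 3) (by omega)
    exact fun c ↦ ⟨0, by rw [map_zero]; exact Subsingleton.elim _ _⟩

/-- **`(αᴺ⁺¹)^* : Hᵏ(Jᴺ⁺¹(ℂ); ℂ) → Hᵏ(Cᴺ⁺¹(ℂ); ℂ)` is onto in every degree for `g ≥ 1`**, granted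
the `H¹` fact — stated as the existence of a morphism `Cᴺ⁺¹ ⟶ Jᴺ⁺¹` onto in cohomology (the
`αᴺ⁺¹ = αᴺ × α` built by recursion, `C¹ = Spec ℂ ⊗ C ≅ C`), by Künneth
(`surjective_complexBetti_map_tensorHom`). [cite: Lange2023AbelianVarietiesC, §4.1.1 and Lemma 4.4.1 (proof)]
[cite: HatcherAT2002, §3.2 Thm. 3.15] -/
theorem exists_surjective_complexBetti_map_pow (h1 : isIso_bettiCohomology_map_abelJacobi)
    (hC : IsSmoothProjective 1 C) (𝒥 : Jacobian C) (P : AlgPoints C ℂ)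
    [Nontrivial (complexBetti C 1)] :
    ∀ N : ℕ, ∃ g : C.pow (N + 1) ⟶ (𝒥.J.powSucc N).X,
      ∀ k, Function.Surjective (complexBetti.map g k).hom
  | 0 => by
    refine ⟨(λ_ C).hom ≫ 𝒥.abelJacobi P, fun k ↦ ?_⟩
    rw [complexBetti.map_comp, ModuleCat.hom_comp, LinearMap.coe_comp]
    exact (surjective_complexBetti_map_of_iso (λ_ C) k).comp
      (surjective_complexBetti_map_abelJacobi h1 hC 𝒥 P k)
  | N + 1 => by
    obtain ⟨g, hg⟩ := exists_surjective_complexBetti_map_pow h1 hC 𝒥 P N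
    exact ⟨g ⊗ₘ 𝒥.abelJacobi P, surjective_complexBetti_map_tensorHom
      (isSmoothProjective_pow_succ_of_curve hC N) hC g (𝒥.abelJacobi P) hg
      (surjective_complexBetti_map_abelJacobi h1 hC 𝒥 P)⟩

/-- A smooth projective curve over `ℂ` has a complex point. [folklore] -/
theorem nonempty_algPoints_of_isSmoothProjective (hC : IsSmoothProjective 1 C) :
    Nonempty (AlgPoints C ℂ) := by
  haveI : IsProper C.hom := IsSmoothProjective.isProper_holds hC
  haveI := hC.geometricallyIrreducible
  haveI : IrreducibleSpace ↥C.left :=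
    GeometricallyIrreducible.irreducibleSpace_of_subsingleton C.hom
  obtain ⟨P, -⟩ := Motives.ComplexPoints.exists_pt_mem (X := C) (Z := Set.univ) Set.univ_nonempty
    isClosed_univ.isLocallyClosed
  exact ⟨P⟩

/-- **`CurvePowerHodgeClassesLiftToJacobianPowers` from its remaining inputs.** The named fact
follows from (1) the `H¹` fact `Motives.isIso_bettiCohomology_map_abelJacobi` (Lange §4.1.1 /
Lemma 4.4.1), (2) the polarisability `smoothProjective_hodgeStructure_isPolarizable` (Voisin I
Thm. 6.32, for Voisin 2025 Cor. 2.12), and (3) the contravariance of algebraic classes along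
morphisms from smooth projective varieties to abelian varieties (Fulton Cor. 19.2 for
`αᴺ⁺¹ : Cᴺ⁺¹ → Jᴺ⁺¹`; on the tree's carriers a moving lemma by translations, not yet proved — a
HYPOTHESIS here, not a named fact): genus `0` (`b₁(C) = 0`) unconditionally by
`curvePowerHodgeClassesLift_of_subsingleton`, genus `≥ 1` by
`exists_surjective_complexBetti_map_pow` and `curvePowerHodgeClassesLift_of_surjective`.
[cite: Voisin2025, Cor. 2.12] [cite: Lange2023AbelianVarietiesC, §4.1.1 and Lemma 4.4.1 (proof)]
[cite: Fulton1998, §19.2 Cor. 19.2 and Example 19.1.11] -/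
theorem CurvePowerHodgeClassesLiftToJacobianPowers_of
    (h1 : isIso_bettiCohomology_map_abelJacobi)
    (hpol : smoothProjective_hodgeStructure_isPolarizable)
    (halg : ∀ ⦃n : ℕ⦄ ⦃X : SchemeOver ℂ⦄, IsSmoothProjective n X →
      ∀ (A : AbelianVariety ℂ) (g : X ⟶ A.X) (p : ℕ),
        ∀ b ∈ algebraicClasses A.X p, complexBetti.map g (2 * p) b ∈ algebraicClasses X p) :
    CurvePowerHodgeClassesLiftToJacobianPowers := by
  intro C hC 𝒥 N p
  rcases subsingleton_or_nontrivial (complexBetti C 1) with hs | hn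
  · exact curvePowerHodgeClassesLift_of_subsingleton hC 𝒥 N p
  · obtain ⟨P⟩ := nonempty_algPoints_of_isSmoothProjective hC
    obtain ⟨g, hg⟩ := exists_surjective_complexBetti_map_pow h1 hC 𝒥 P N
    exact curvePowerHodgeClassesLift_of_surjective hpol hC 𝒥 N p g (hg (2 * p))
      (halg (isSmoothProjective_pow_succ_of_curve hC N) (𝒥.J.powSucc N) g p)

/-- **`CurvePowerHodgeClassesLiftToJacobianPowers` from the two remaining NAMED FACTS.** Input (3)
of `CurvePowerHodgeClassesLiftToJacobianPowers_of` — pull-back along a morphism from a smooth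
projective variety to an abelian variety preserves algebraic classes (Fulton, Cor. 19.2 (b), for
`αᴺ⁺¹ : Cᴺ⁺¹ → Jᴺ⁺¹`) — is now a THEOREM of the tree
(`forall_map_mem_algebraicClasses_of_abelianVariety`, `AbelianVarietyPullbackAlgebraicClasses`:
moving by translations and the dimension of the general fibre), so the fact follows from
(1) `Motives.isIso_bettiCohomology_map_abelJacobi` (`(f^P)^* : H¹(J) ≅ H¹(C)`, Lange §4.1.1 /
Lemma 4.4.1) and (2) `smoothProjective_hodgeStructure_isPolarizable` (Voisin I Thm. 6.32, feeding
Voisin 2025 Cor. 2.12) alone; `CurvePowerHodgeClassesLiftToJacobianPowers_holds` is the one-line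
application once both are discharged. [cite: Voisin2025, Cor. 2.12 and Prop. 2.11]
[cite: Lange2023AbelianVarietiesC, §4.1.1 and Lemma 4.4.1 (proof)] [cite: Fulton1998, §19.2 Cor. 19.2 (b)] -/
theorem CurvePowerHodgeClassesLiftToJacobianPowers_of_isIso_of_isPolarizable
    (h1 : isIso_bettiCohomology_map_abelJacobi)
    (hpol : smoothProjective_hodgeStructure_isPolarizable) :
    CurvePowerHodgeClassesLiftToJacobianPowers :=
  CurvePowerHodgeClassesLiftToJacobianPowers_of h1 hpol
    forall_map_mem_algebraicClasses_of_abelianVariety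

/-- **`CurvePowerHodgeClassesLiftToJacobianPowers` from the LEAF facts of the decomposition.**
The `H¹` fact `Motives.isIso_bettiCohomology_map_abelJacobi` was decomposed (librarian,
`Motives/JacobianFirstCohomologyAssembly`) into `Motives.two_mul_dim_eq_finrank_bettiCohomology`
(`2 dim J = b₁(C(ℂ))`, Milne Prop. 2.1 with Thm. 2.5; Lange §4.1.1) and the torsion count
`AbelianVariety.natCard_torsionPoints_of_isAlgClosed`, the latter now a THEOREM
(`natCard_torsionPoints_of_isAlgClosed_holds`), and the tree proves the two `H¹`/dimension facts
equivalent (`Motives.two_mul_dim_eq_finrank_bettiCohomology_iff_isIso`, their common residual content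
being the inequality `b₁(C(ℂ)) ≤ 2 dim J`). Hence the fact follows from
`two_mul_dim_eq_finrank_bettiCohomology` and `smoothProjective_hodgeStructure_isPolarizable` alone.
[cite: Milne1986JacobianVarieties, §2 Prop. 2.1 and Thm. 2.5] [cite: Voisin2025, Cor. 2.12 and Prop. 2.11]
[cite: Lange2023AbelianVarietiesC, §4.1.1 and Lemma 4.4.1 (proof)] -/
theorem CurvePowerHodgeClassesLiftToJacobianPowers_of_two_mul_dim_eq_of_isPolarizable
    (h : two_mul_dim_eq_finrank_bettiCohomology)
    (hpol : smoothProjective_hodgeStructure_isPolarizable) :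
    CurvePowerHodgeClassesLiftToJacobianPowers :=
  CurvePowerHodgeClassesLiftToJacobianPowers_of_isIso_of_isPolarizable
    (isIso_bettiCohomology_map_abelJacobi_of_two_mul_dim_eq h) hpol

/-- The same from the residual INEQUALITY `b₁(C(ℂ)) ≤ 2 dim J(C)` for the Jacobians of smooth
projective complex curves (Lange §4.1.1: `rk H₁(C, ℤ) = 2g = 2 dim J`; the other inequality
`2 dim J ≤ b₁(C(ℂ))` is the tree's theorem `Jacobian.two_mul_dim_le_finrank_bettiCohomology`), through
`Motives.isIso_bettiCohomology_map_abelJacobi_of_finrank_le_two_mul_dim`, and the polarizability fact.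
[cite: Lange2023AbelianVarietiesC, §4.1.1 and Lemma 4.4.1 (proof)] [cite: Voisin2025, Cor. 2.12] -/
theorem CurvePowerHodgeClassesLiftToJacobianPowers_of_finrank_le_of_isPolarizable
    (h : ∀ (C : SchemeOver ℂ), IsSmoothProjective 1 C → ∀ (𝒥 : Jacobian C),
      Module.finrank ℚ (bettiCohomology C 1) ≤ 2 * 𝒥.J.dim)
    (hpol : smoothProjective_hodgeStructure_isPolarizable) :
    CurvePowerHodgeClassesLiftToJacobianPowers :=
  CurvePowerHodgeClassesLiftToJacobianPowers_of_isIso_of_isPolarizable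
    (isIso_bettiCohomology_map_abelJacobi_of_finrank_le_two_mul_dim h) hpol

end Surjectivity


/-! ### `FermatHodgeClassesLiftToCurvePowers` is false: the unconditional refutation

The OTHER named fact of `FermatHodgeClassesLiftToCurveAndJacobianPowers`,
`FermatHodgeClassesLiftToCurvePowers` (attributed to Shioda–Katsura 1979 / Shioda 1979), is
MIS-STATED — it asks, for ALL `m, n, p`, for a linear map `H²ᵖ((X¹ₘ)ⁿ(ℂ)) → H²ᵖ(Xⁿₘ(ℂ))`
carrying algebraic classes to algebraic classes and hitting every rational `(p,p)`-class by a
rational `(p,p)`-class, whereas the sources only provide the inductive structure through the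
`2m - 2` blow-up / `μₘ`-quotient correspondences (Shioda–Katsura Thm. 2.10, Shioda Thm. I; see the
module docstring of the fact file). That file proves the refutation
`not_fermatHodgeClassesLiftToCurvePowers_of_finrank` CONDITIONALLY on two classical Betti-number
inputs at `(m, n, p) = (3, 2, 1)`; they are now theorems on the tree's real carriers:

* `h₆`: `dim_ℂ H²((X¹₃ × X¹₃)(ℂ); ℂ) ≤ 6` — the Fermat cubic CURVE is a smooth plane cubic,
  `b₁ ≤ 2` (nowhere-vanishing residue `1`-form; every holomorphic `1`-form is a constant multiple of
  it; Hodge decomposition) and Künneth (`PlaneCubicFirstBetti`);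
* `h₇`: `7 ≤ dim_ℂ span{rational (1,1)-classes of H²(X²₃(ℂ); ℂ)}` — seven lines of the Fermat
  cubic SURFACE in lower-triangular position have linearly independent, rational, type-`(1,1)`
  classes (`FermatCubicSurfaceSevenLines`; in print `ρ(X²₃) = 7`, Hartshorne V Prop. 4.8 /
  Ex. 4.16, Aoki–Shioda (2.3)).
-/

section FermatRefutation

-- names the `@[deprecated]` record `FermatHodgeClassesLiftToCurvePowers` of
-- `FermatHodgeClassesLiftToCurveAndJacobianPowers.lean` on purpose: this IS its refutation (verdict clean-up
-- 2026-08-16, p120192); REMOVE-WHEN the record is deleted from that file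
set_option linter.deprecated false in
/-- **`FermatHodgeClassesLiftToCurvePowers` is false.** At `(m, n, p) = (3, 2, 1)` the asserted
linear map `F : H²((X¹₃)²(ℂ); ℂ) → H²(X²₃(ℂ); ℂ)` would have to hit every rational `(1,1)`-class
by a rational `(1,1)`-class; but its source has dimension `≤ 6`
(`finrank_complexBetti_two_pow_two_fermatCubicCurve_le`) while the rational `(1,1)`-classes of
the Fermat cubic surface span a space of dimension `≥ 7`
(`seven_le_finrank_span_rational_one_one`, for the orientation family given by the
`ℂ`-orientations `Motives.ComplexPoints.isOrientableOver`). The corrected inductive structure is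
Shioda–Katsura Thm. 2.10 / Shioda Thm. I (blow-up and `μₘ`-quotient correspondences), not a map
from `(X¹ₘ)ⁿ`. [cite: ShiodaKatsura1979, Thm. 2.6 and Thm. 2.10] [cite: Hartshorne1977, V Prop. 4.8 and Ex. 4.16]
[cite: AokiShioda1983, §2 (2.3)] -/
theorem not_fermatHodgeClassesLiftToCurvePowers : ¬ FermatHodgeClassesLiftToCurvePowers := by
  haveI := finite_complexBetti_two_pow_two_fermatCubicCurve
  let μ₀ : OrientationFamily := fun _ _ hX ↦ (Motives.ComplexPoints.isOrientableOver ℂ hX).some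
  have h₇ : 7 ≤ Module.finrank ℂ (Submodule.span ℂ {c : complexBetti (fermatHypersurface 2 3) (2 * 1) |
      IsRationalClass c ∧ IsOfHodgeType 2 (fermatHypersurface 2 3) (2 * 1) 1 1 c}) :=
    seven_le_finrank_span_rational_one_one μ₀
  exact not_fermatHodgeClassesLiftToCurvePowers_of_finrank
    finrank_complexBetti_two_pow_two_fermatCubicCurve_le h₇

end FermatRefutation

end Literature.AlgebraicGeometry.HodgeTheory

end
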